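import Literature.MathematicalPhysics.QuantumFieldTheory.Balaban1983to89.B8Eq1117FrechetAnalytic
import Literature.MathematicalPhysics.QuantumFieldTheory.Balaban1983to89.B8Eq1119LambdaSpace

/-!
# `Balaban1983to89.B8Eq1119LambdaAnalytic` — T. Bałaban, *Spaces of regular gauge field configurations on a lattice and gauge fixing
# conditions*, Commun. Math. Phys. **99** (1985) 75–102 [Balaban1985RegularSpaces], Sect. E p. 97: «This solution is an analytic
# function of λ defined on the set of λ satisfying (1.119)» ON THE BANACH λ-SPACE OF (1.119) (unit r05's `B8Eq1119LambdaSpace`) FOR THE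
# CONCRETE LATTICE `C′`/`D′` — UNCONDITIONAL (the hypothesis «`C′` analytic» of `B8Eq1119LambdaSpace.Dprime_concrete_analyticAt_of_analytic`
# discharged; file 5 of the series `B8CprimeCurveAnalytic` → `B8Eq1118PicardAnalytic` → `B8Eq1117ConcreteAnalytic` → `B8Eq1117FrechetAnalytic`)

statement-level skeleton of published theorems with citation tags; proofs where landed; nothing here is a claim about the Yang–Mills mass gap

PDF held: `paper:balaban1985-cmp99-regular-spaces-gauge-fixing` (journal page = PDF page + 74); p. 97 [PDF 23] (text layer `p0023.txt`
L12–L13, this unit, 2026-08-21): «exists exactly one solution of Eq. (1.117). This solution is an analytic function of λ defined on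
the set of λ satisfying (1.119).»; [3] = [Balaban1985Averaging] p. 50 (208).

CITATION HEADER (lean-in-tree rule).  Cell `lit-balaban` (HOME `run/shared/lean/pub/lit-balaban/`), unit `lit-balaban-p05` (Phase-2 proof
seat p05, gen 6; TAKING line HOME/STATUS.md 2026-08-21T09:39:21Z; free-target protocol G.5-34(d); owner of block B8 = `lit-balaban-r05`,
referee ref-4).  Rows served: **`B8.Eq1.113`** / **`B8.Claim@97`** (interface E-B8-19 of `HOME/lit-balaban-r05/INTERFACES-B8.md`).
THE KNITTING: unit r05's `B8Eq1119LambdaSpace` (p260196) packages the set (1.119) as the ball `‖s‖ < ½α₄` of the complex Banach space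
`lamSub U₀ (Lᵏ)` (norm = print's modulus `max{|λ|, Lᵏ|D_{U₀}λ|}`), puts the concrete `C′` on it as `Cc := CnlF ∘ lamOf`, identifies
the abstract `D′` with p05's concrete `D′`, and proves «`D′` analytic» CONDITIONALLY on `hA : ‖μ‖ < α₄ → AnalyticAt ℂ Cc μ`
(`Dprime_concrete_analyticAt_of_analytic`, HONEST SCOPE there).  File 4 of this series (`B8Eq1117FrechetAnalytic`) proves exactly such
analyticity for every sitewise-analytic parametrisation; the site evaluations `s ↦ λ_s(x)` of `lamSub` are continuous linear, so:

WHAT THIS FILE PROVES (kernel, no `sorry`, standard axioms; theorems only; standing hypotheses = r05's `B8Eq1119LambdaSpace` §3 =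
p05's `B8Eq1117Concrete.eq1117_existsUnique` + `0 < α₄`):
* `analyticAt_lamOf_apply` — the site evaluations of the λ-space are analytic (continuous linear).
* **`analyticOnNhd_Cc`** / **`hA_discharged`** — [3] (208) on the λ-space: `Cc = C′ ∘ lamOf` is analytic on the ball `‖μ‖ < α₄` (= the
  set (1.120)) as a map `lamSub U₀ (Lᵏ) → XSpace d k 𝔸`; i.e. the hypothesis `hA` of r05's conditional theorem HOLDS.
* **`Dprime_concrete_analyticAt`** — p. 97 «This solution is an analytic function of λ defined on the set of λ satisfying (1.119)»,
  UNCONDITIONAL, on the λ-space: `s ↦ D′(λ_s)` (p05's concrete `B8Eq1113Concrete.Dprime`) is analytic at every `‖s₀‖ < ½α₄` — r05's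
  `Dprime_concrete_analyticAt_of_analytic` with `hA := hA_discharged` (route 1: analytic implicit function theorem, r05's abstract
  `B8Eq1117Analytic`); **`analyticOnNhd_Dprime_lamOf`** — the same conclusion on the whole half ball by route 2 (this series: Picard
  iteration + Graves–Taylor–Hille–Zorn, file 4 `analyticOnNhd_Dprime_comp_param`), independent of route 1.
* `linMap_concrete_analyticAt` — (1.113): `s ↦ s − H′c D′(λ_s)` is analytic at every `‖s₀‖ < ½α₄` (`H′c` = r05's `Hc`).
READINGS: as in the series and in `B8Eq1119LambdaSpace` (one-level weight `w = Lᵏ`; `𝔤ᶜ`-values; `H′` abstract; `C′₂ := 2·C2p d`,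
GAPS G-B8-17).  NOT CLAIMED: the lattice `H′` (row B8.Eq1.91 / I-B8-2).
REUSED BY NAME: `B8Eq1119LambdaSpace.lamSub, lamOf, Cc, sitewise_of_norm_lt, Dprime_concrete_analyticAt_of_analytic` (r05),
`B8Eq1117FrechetAnalytic.analyticOnNhd_CnlF_comp_param, analyticOnNhd_Dprime_comp_param` (this unit), Mathlib
`ContinuousLinearMap.analyticAt`, `Submodule.subtypeL`, `BoundedContinuousFunction.evalCLM`.
Unit `lit-balaban-p05` (gen 6), 2026-08-21.  Nothing here is new mathematics.

[cite: Balaban1985RegularSpaces, p.97 («This solution is an analytic function of λ defined on the set of λ satisfying (1.119)»),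
(1.119)–(1.121) p.96; Balaban1985Averaging, (208) p.50; Chae1985, Thm 14.9, Thm 14.13]
-/

noncomputable section

open NormedSpace Finset Metric Set Filter
open scoped BoundedContinuousFunction Topology NNReal

namespace Literature.MathematicalPhysics.QuantumFieldTheory.Balaban1983to89.B8Eq1119LambdaAnalytic

open B7Prop1Explicit B7Prop2Explicit MatrixLog B7Eq167Flat B7Prop9Flat B7Prop10General
open B7Prop10Flat (one_le_C5 C4'_nonneg C5'_nonneg)
open B7Eq214General (Cgen)
open B7Eq170Flat (cj)
open B8Ineq125Concrete (C2p C2p_nonneg)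
open B8Eq1117Concrete (XSpace CnlF)
open B8Eq1113Concrete (Dprime)
open B8Eq1119LambdaSpace (PSpace lamSub lamOf Cc sitewise_of_norm_lt Dprime_concrete_analyticAt_of_analytic)
open B8Eq1117FrechetAnalytic (analyticOnNhd_CnlF_comp_param analyticOnNhd_Dprime_comp_param)

-- `Site` alone would resolve to the torus sites of `Setup.lean`; re-export the `ℤ^d` sites of `B7Prop1Explicit`.
export B7Prop1Explicit (Site)

variable {d : ℕ}

section Eval

variable {𝔸 : Type*} [NormedRing 𝔸] [NormedAlgebra ℂ 𝔸]

/-- **The site evaluations of the λ-space are analytic**: `s ↦ λ_s(x) = s(inl x)` is the composite of the subtype inclusion and the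
evaluation at `inl x`, a continuous linear map `lamSub U₀ w →L[ℂ] 𝔸`. [cite: Balaban1985RegularSpaces, (1.119) p.96] (plumbing; our proof) -/
theorem analyticAt_lamOf_apply {U₀ : Site d → Fin d → 𝔸ˣ} {w : ℝ} (x : Site d) (s₀ : lamSub U₀ w) :
    AnalyticAt ℂ (fun s : lamSub U₀ w => lamOf s x) s₀ := by
  let ℓ : lamSub U₀ w →L[ℂ] 𝔸 :=
    (BoundedContinuousFunction.evalCLM ℂ (Sum.inl x : B8Eq1119LambdaSpace.PairIdx d)).comp (lamSub U₀ w).subtypeL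
  have hℓ : (fun s : lamSub U₀ w => lamOf s x) = ⇑ℓ := funext fun s => rfl
  rw [hℓ]
  exact ℓ.analyticAt s₀

end Eval

section Standing

variable {𝔸 : Type*} [NormedRing 𝔸] [NormOneClass 𝔸] [NormedAlgebra ℂ 𝔸] [CompleteSpace 𝔸]
variable {L : ℕ} {G : Subgroup 𝔸ˣ} {U₀ : Site d → Fin d → 𝔸ˣ} {k : ℕ} {u₁ : Site d → 𝔸ˣ}
  {α₀ α₃ α₄ B₀' : ℝ} {H' : XSpace d k 𝔸 →ₗ[ℂ] (Site d → 𝔸)}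

variable (hL : 2 ≤ L) (hG : AvgClosed d L G) (hU : ∀ x κ, U₀ x κ ∈ G)
  (hα : 0 < α₀) (hα3 : C0 d * α₀ ≤ 1 / 3) (hα2 : 2 * α₀ ≤ c2' d L)
  (h52 : pdev U₀ < α₀ * (((L : ℝ) ^ k)⁻¹) ^ 2)
  (hB : 0 < B₀')
  (hH0 : ∀ (X : XSpace d k 𝔸) (x : Site d), ‖H' X x‖ ≤ B₀' * ‖X‖)
  (hH1 : ∀ (X : XSpace d k 𝔸) (x : Site d) (κ : Fin d),
    ‖cj (U₀ x κ) (H' X (x + e κ)) - H' X x‖ ≤ B₀' * ‖X‖ * ((L : ℝ) ^ k)⁻¹)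
  (hu₁ : InLambda L U₀ u₁ k α₃ (((L : ℝ) ^ k)⁻¹))
  (hα₃ : 0 ≤ α₃) (hα₃' : α₃ ≤ 1 / 200) (hα₄ : 0 < α₄)
  (hs₁ : 200 * C6 d * (2 * α₄) ≤ 1) (hs₂ : 12000 * ((d : ℝ) + 1) * L * (2 * α₄) ≤ 1)
  (hs₃ : C4G d L * (α₀ + α₃ + 4 * (2 * α₄)) ≤ 1)
  (hs₄ : 1024 * ((d : ℝ) + 1) * ((d : ℝ) + 4) * L ^ 2 * α₀ ≤ 1) (hs₅ : 32 * ((d : ℝ) + 1) ^ 2 * C6 d * L ^ 2 * α₀ ≤ 1)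
  (hs₆ : 16 * d * C5' d * C6 d * (L : ℝ) ^ 2 * α₀ ≤ 1) (hs₇ : 8 * d * C6 d * L * α₀ ≤ 1)

include hL hG hU hα hα3 hα2 h52 hu₁ hα₃ hα₃' hα₄ hs₁ hs₂ hs₃ hs₄ hs₅ hs₆ hs₇

/-- **[3] (208) on the λ-space of (1.119): the concrete `C′` is analytic on the ball `‖μ‖ < α₄`** (= the set (1.120)) as a map
`lamSub U₀ (Lᵏ) → XSpace d k 𝔸` — file 4's `analyticOnNhd_CnlF_comp_param` with the sitewise-analytic parametrisation `lamOf` and the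
(207)-membership of the ball (`B8Eq1119LambdaSpace.sitewise_of_norm_lt`).
[cite: Balaban1985Averaging, (208) p.50; Balaban1985RegularSpaces, (1.120)–(1.121) p.96; Chae1985, Thm 14.9, Thm 14.13] -/
theorem analyticOnNhd_Cc :
    AnalyticOnNhd ℂ (Cc L U₀ u₁ k) {μ : lamSub U₀ ((L : ℝ) ^ k) | ‖μ‖ < α₄} := by
  have hC6 : (0 : ℝ) ≤ C6 d := by unfold C6; linarith [one_le_C5 (d := d)]
  have hC4G : 0 ≤ C4G d L := by
    have h7 : (0 : ℝ) ≤ C7 d := by unfold C7 C6; linarith [one_le_C5 (d := d), C5'_nonneg (d := d)]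
    have h4' := C4'_nonneg (d := d)
    unfold C4G; positivity
  -- the (214)-hypotheses at `α₄` follow from those at `2α₄`
  have hs₁' : 200 * C6 d * α₄ ≤ 1 := by nlinarith
  have hs₂' : 12000 * ((d : ℝ) + 1) * L * α₄ ≤ 1 := by
    have : (0 : ℝ) ≤ 12000 * ((d : ℝ) + 1) * L := by positivity
    nlinarith
  have hs₃' : C4G d L * (α₀ + α₃ + 4 * α₄) ≤ 1 := by nlinarith
  have hopen : IsOpen {μ : lamSub U₀ ((L : ℝ) ^ k) | ‖μ‖ < α₄} := isOpen_lt continuous_norm continuous_const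
  have hmem : ∀ μ ∈ {μ : lamSub U₀ ((L : ℝ) ^ k) | ‖μ‖ < α₄},
      (∀ (x : Site d) (κ : Fin d), ‖cj (U₀ x κ) (lamOf μ (x + e κ)) - lamOf μ x‖ < α₄ * ((L : ℝ) ^ k)⁻¹) ∧
        ∀ x : Site d, ‖lamOf μ x‖ < α₄ := fun μ hμ => sitewise_of_norm_lt (U₀ := U₀) hL hμ
  exact analyticOnNhd_CnlF_comp_param (E := lamSub U₀ ((L : ℝ) ^ k)) (γ := fun s => lamOf s) hL hG hU hopen
    (fun x s _ => analyticAt_lamOf_apply x s) hα hα3 hα2 h52 (fun μ hμ => (hmem μ hμ).1) (fun μ hμ => (hmem μ hμ).2) hu₁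
    hα₃ hα₃' hs₁' hs₂' hs₃' hs₄ hs₅ hs₆ hs₇

/-- **The hypothesis `hA` of `B8Eq1119LambdaSpace.Dprime_concrete_analyticAt_of_analytic` HOLDS**: `Cc` is analytic at every `μ` of
modulus `< α₄`. [cite: Balaban1985Averaging, (208) p.50; Balaban1985RegularSpaces, (1.120) p.96] -/
theorem hA_discharged : ∀ μ : lamSub U₀ ((L : ℝ) ^ k), ‖μ‖ < α₄ → AnalyticAt ℂ (Cc L U₀ u₁ k) μ :=
  fun μ hμ => analyticOnNhd_Cc hL hG hU hα hα3 hα2 h52 hu₁ hα₃ hα₃' hα₄ hs₁ hs₂ hs₃ hs₄ hs₅ hs₆ hs₇ μ hμ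

include hB hH0 hH1 in
/-- **p. 97 «This solution is an analytic function of λ defined on the set of λ satisfying (1.119)» — CONCRETE `D′` ON THE λ-SPACE,
UNCONDITIONAL (route 1)**: for the concrete lattice `C′ = C′_j(u₁, ·)`, the abstract bounded `H′`, and every `s₀` in the set (1.119)
(= the ball `‖s₀‖ < ½α₄` of `lamSub U₀ (Lᵏ)`), the solution `s ↦ D′(λ_s)` (p05's `B8Eq1113Concrete.Dprime`, radius `α₄/(2B′₀)`) is
`ℂ`-analytic at `s₀` — r05's `Dprime_concrete_analyticAt_of_analytic` (analytic implicit function theorem) with its hypothesis `hA`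
discharged by `hA_discharged`. [cite: Balaban1985RegularSpaces, p.97 («This solution is an analytic function of λ defined on the set of λ satisfying (1.119)»); Balaban1985Averaging, (208) p.50] -/
theorem Dprime_concrete_analyticAt (hsm : α₃ + α₄ ≤ 1 / (4 * B₀' * (2 * C2p d)))
    {s₀ : lamSub U₀ ((L : ℝ) ^ k)} (hs₀ : ‖s₀‖ < α₄ / 2) :
    AnalyticAt ℂ (fun s : lamSub U₀ ((L : ℝ) ^ k) => Dprime L U₀ u₁ k H' (α₄ / (2 * B₀')) (lamOf s)) s₀ :=
  Dprime_concrete_analyticAt_of_analytic hL hG hU hα hα3 hα2 h52 hB hH0 hH1 hu₁ hα₃ hα₃' hα₄ hs₁ hs₂ hs₃ hs₄ hs₅ hs₆ hs₇ hsm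
    (hA_discharged hL hG hU hα hα3 hα2 h52 hu₁ hα₃ hα₃' hα₄ hs₁ hs₂ hs₃ hs₄ hs₅ hs₆ hs₇) hs₀

include hB hH0 hH1 in
/-- **The same, route 2 (this series), on the whole half ball**: `s ↦ D′(λ_s)` is analytic on `{‖s‖ < ½α₄}` — file 4's
`analyticOnNhd_Dprime_comp_param` (Picard iteration + Graves–Taylor–Hille–Zorn) with the parametrisation `lamOf`; independent of the
implicit-function route. [cite: Balaban1985RegularSpaces, p.97 («This solution is an analytic function of λ defined on the set of λ satisfying (1.119)»); Chae1985, Thm 14.9, Thm 14.13] -/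
theorem analyticOnNhd_Dprime_lamOf (hsm : α₃ + α₄ ≤ 1 / (4 * B₀' * (2 * C2p d))) :
    AnalyticOnNhd ℂ (fun s : lamSub U₀ ((L : ℝ) ^ k) => Dprime L U₀ u₁ k H' (α₄ / (2 * B₀')) (lamOf s))
      {s : lamSub U₀ ((L : ℝ) ^ k) | ‖s‖ < α₄ / 2} := by
  have hopen : IsOpen {s : lamSub U₀ ((L : ℝ) ^ k) | ‖s‖ < α₄ / 2} := isOpen_lt continuous_norm continuous_const
  have hmem : ∀ s ∈ {s : lamSub U₀ ((L : ℝ) ^ k) | ‖s‖ < α₄ / 2},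
      (∀ (x : Site d) (κ : Fin d), ‖cj (U₀ x κ) (lamOf s (x + e κ)) - lamOf s x‖ < α₄ / 2 * ((L : ℝ) ^ k)⁻¹) ∧
        ∀ x : Site d, ‖lamOf s x‖ < α₄ / 2 := fun s hs => sitewise_of_norm_lt (U₀ := U₀) hL hs
  exact analyticOnNhd_Dprime_comp_param (E := lamSub U₀ ((L : ℝ) ^ k)) (γ := fun s => lamOf s) hL hG hU H' hα hα3 hα2 h52 hB
    hH0 hH1 hopen (fun x s _ => analyticAt_lamOf_apply x s) (fun s hs => (hmem s hs).1) (fun s hs => (hmem s hs).2) hu₁ hα₃ hα₃'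
    hα₄ hs₁ hs₂ hs₃ hs₄ hs₅ hs₆ hs₇ hsm

include hB hH0 hH1 in
/-- **The linearizing transformation (1.113) `λ′ = λ − H′D′(λ)` is analytic on the set (1.119)** — concrete `D′`, on the λ-space:
`s ↦ s − H′c D′(λ_s)` (`H′c` = r05's bounded `B8Eq1119LambdaSpace.Hc`, the abstract `H′` read into the λ-space) is `ℂ`-analytic at
every `‖s₀‖ < ½α₄` (from `Dprime_concrete_analyticAt`; `H′c` is continuous linear).  Abstract twin: `B8Eq1117Analytic.linMap_analyticAt`.
[cite: Balaban1985RegularSpaces, (1.113) p.95, p.97 («This solution is an analytic function of λ»)] -/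
theorem linMap_concrete_analyticAt (hsm : α₃ + α₄ ≤ 1 / (4 * B₀' * (2 * C2p d)))
    {s₀ : lamSub U₀ ((L : ℝ) ^ k)} (hs₀ : ‖s₀‖ < α₄ / 2) :
    AnalyticAt ℂ (fun s : lamSub U₀ ((L : ℝ) ^ k) =>
      s - B8Eq1119LambdaSpace.Hc U₀ (by positivity : (0 : ℝ) < (L : ℝ) ^ k) H' hB.le hH0 hH1
        (Dprime L U₀ u₁ k H' (α₄ / (2 * B₀')) (lamOf s))) s₀ := by
  have hD := Dprime_concrete_analyticAt hL hG hU hα hα3 hα2 h52 hB hH0 hH1 hu₁ hα₃ hα₃' hα₄ hs₁ hs₂ hs₃ hs₄ hs₅ hs₆ hs₇ hsm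
    hs₀
  have hHD : AnalyticAt ℂ (fun s : lamSub U₀ ((L : ℝ) ^ k) =>
      B8Eq1119LambdaSpace.Hc U₀ (by positivity : (0 : ℝ) < (L : ℝ) ^ k) H' hB.le hH0 hH1
        (Dprime L U₀ u₁ k H' (α₄ / (2 * B₀')) (lamOf s))) s₀ :=
    (ContinuousLinearMap.analyticAt _ _).comp hD
  exact analyticAt_id.sub hHD

end Standing

end Literature.MathematicalPhysics.QuantumFieldTheory.Balaban1983to89.B8Eq1119LambdaAnalytic

end
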